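import Mathlib
import Summits.Ventures.HodgeRepro.ZariskiDense

/-!
# R5 steps (3)–(4): a rational point at which the evaluated eigenforms are independent (seat p3)

ROUTE.md A4 / ROUTE-C R5 step (4) ends with the sentence: *choose successively `w_σ ∈ M_σ` with
`ω_σ(w_σ)_x` outside the span of the previous ones (possible as long as `g′ = |Ψ_T| ≤ p`, by (3));
the image of `M → ∏_σ M_σ`, `v ↦ (σ(v))_σ`, is Zariski dense, hence some `v ∈ M` gives `g′`
holomorphic forms linearly independent at `x`.*  Seat typer-2 kernel-checked the density
(`ZariskiDense.lean`: `exists_eval_embeddings_pi_ne_zero`); this file kernel-checks the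
APPLICATION — the passage from a complex witness to a `T`-rational one — in the linear-algebra
shape the route uses:

* `T` is a number field (the CM field `End⁰(B)` of a simple factor), `M = T^m` its multiplicity
  space (`m = dim_T M`), `σ_i : T → ℂ` the embeddings of the CM type `Ψ_T` (distinct: `e` injective,
  or `σ` injective in the one-copy form), and for each `i` a `ℂ`-linear map
  `ω i : ℂ^m → ℂ^p` — "evaluate the `σ_i`-eigenform attached to `w ∈ M_{σ_i} = M ⊗_{T,σ_i} ℂ` at the
  point `x`" (`p = dim S`, the cotangent space `T_x^*`).  A rational vector `v ∈ T^m` is read in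
  the `σ_i`-component as `(σ_i(v_j))_j ∈ ℂ^m`.
* `exists_rat_linearIndependent`: if SOME complex data `w_i ∈ ℂ^m` make `(ω i (w i))_i` linearly
  independent, then SOME rational `v` makes `(ω i ((σ_i(v_j))_j))_i` linearly independent.  Proof:
  `B` := a left inverse of the matrix with columns `ω i (w i)`; `P(x) := det (B · U(x))`, `U(x)`
  the matrix of the vectors read off the variables `x : (copy × coordinate) × Hom(T,ℂ) → ℂ`, is a
  polynomial with `P(witness) = det 1 = 1 ≠ 0`; typer-2's density gives a rational point with
  `P ≠ 0`, i.e. `B · U(v)` invertible, so the columns of `U(v)` are independent.  The general form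
  allows `r` copies (`r` rational vectors `v_1, …, v_r ∈ T^m`, the "repeated factor `B^r`" case of
  R5 step (5)): the index `i` names its copy `(e i).1` and its embedding `(e i).2`.
* `exists_rat_linearIndependent_of_surjective` (steps (3)+(4) together): if each `ω i` is
  SURJECTIVE onto `ℂ^p` — "each eigen-system `{ω_σ(w)}` spans `T_x^*`", step (3) — and
  `g′ = |ι| ≤ p`, then a rational `v` with `g′` independent evaluated eigenforms exists.

Everything is Mathlib plus typer-2's `ZariskiDense.lean`; no Hodge-theoretic object is modelled
(13.2(a)/(c) of ROUTE-C stay paper sentences).  Nothing here says anything about the status of the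
Hodge conjecture for CM abelian varieties, which is NOT proved.
-/

set_option autoImplicit false

namespace HodgeRepro.Zariski

open MvPolynomial Matrix

section leftInverse

variable {ι p : Type*} [Fintype ι] [DecidableEq ι] [Fintype p] [DecidableEq p]

/-- A linearly independent family `u` in `ℂ^p` has a left inverse matrix:
`B * (matrix with columns u) = 1`. -/
theorem exists_leftInverse_of_linearIndependent (u : ι → (p → ℂ)) (hu : LinearIndependent ℂ u) :
    ∃ B : Matrix ι p ℂ, B * Matrix.of (fun r i => u i r) = 1 := by
  have hinj : Function.Injective (Matrix.of fun r i => u i r).mulVec := by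
    rw [Matrix.mulVec_injective_iff]; exact hu
  have hker : LinearMap.ker (Matrix.of fun r i => u i r).mulVecLin = ⊥ := by
    rw [LinearMap.ker_eq_bot, Matrix.coe_mulVecLin]; exact hinj
  obtain ⟨g, hg⟩ := LinearMap.exists_leftInverse_of_injective _ hker
  refine ⟨LinearMap.toMatrix' g, ?_⟩
  have h := LinearMap.toMatrix'_comp g (Matrix.of fun r i => u i r).mulVecLin
  rw [hg, LinearMap.toMatrix'_id, ← Matrix.toLin'_apply', LinearMap.toMatrix'_toLin'] at h
  exact h.symm

omit [DecidableEq p] in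
/-- If `B * (matrix with columns u)` is invertible then `u` is linearly independent. -/
theorem linearIndependent_of_isUnit_mul (u : ι → (p → ℂ)) (B : Matrix ι p ℂ)
    (hB : IsUnit (B * Matrix.of fun r i => u i r)) : LinearIndependent ℂ u := by
  have hinj : Function.Injective (Matrix.of fun r i => u i r).mulVec := by
    intro c c' hcc'
    have h2 : (B * Matrix.of fun r i => u i r) *ᵥ c = (B * Matrix.of fun r i => u i r) *ᵥ c' := by
      rw [← Matrix.mulVec_mulVec, ← Matrix.mulVec_mulVec, hcc']
    exact Matrix.mulVec_injective_iff_isUnit.mpr hB h2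
  exact Matrix.mulVec_injective_iff.mp hinj

end leftInverse

section density

variable (K : Type*) [Field K] [NumberField K]

/-- typer-2's `exists_eval_embeddings_pi_ne_zero` with an arbitrary finite copy index `κ` in place
of `Fin n` (rename the variables along `Fintype.equivFin κ`). -/
theorem exists_eval_embeddings_fintype_ne_zero {κ : Type*} [Fintype κ]
    (P : MvPolynomial (κ × (K →ₐ[ℚ] ℂ)) ℂ) (hP : P ≠ 0) :
    ∃ a : κ → K, eval (fun q => q.2 (a q.1)) P ≠ 0 := by
  set f : κ × (K →ₐ[ℚ] ℂ) → Fin (Fintype.card κ) × (K →ₐ[ℚ] ℂ) :=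
    Prod.map (Fintype.equivFin κ) id with hf
  have hfinj : Function.Injective f :=
    (Fintype.equivFin κ).injective.prodMap Function.injective_id
  have hP' : rename f P ≠ 0 := by
    intro h
    apply hP
    apply rename_injective f hfinj
    rw [h, map_zero]
  obtain ⟨a, ha⟩ := exists_eval_embeddings_pi_ne_zero K (Fintype.card κ) (rename f P) hP'
  refine ⟨fun k => a (Fintype.equivFin κ k), ?_⟩
  rw [eval_rename] at ha
  have hfun : ((fun q : Fin (Fintype.card κ) × (K →ₐ[ℚ] ℂ) => q.2 (a q.1)) ∘ f) =
      fun q : κ × (K →ₐ[ℚ] ℂ) => q.2 (a (Fintype.equivFin κ q.1)) := by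
    funext q
    rfl
  rw [hfun] at ha
  exact ha

end density

section main

variable {ι r m p : Type*} [Fintype ι] [DecidableEq ι] [Fintype r] [DecidableEq r] [Fintype m]
  [Fintype p] [DecidableEq p]
variable (K : Type*) [Field K] [NumberField K]

/-- **R5 step (4), the rational point (general form, `r` copies).**  `e i = (copy, embedding)`
injective; `ω i : ℂ^m → ℂ^p` linear.  If some complex data `w` make `(ω i (w i))_i` linearly
independent, some rational data `v : r → m → K` make `(ω i ((e i).2 (v (e i).1 j))_j)_i` linearly
independent.

Proof: `B` := a left inverse of the matrix with columns `ω i (w i)`; the polynomial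
`P := det (B * U(x))` in the variables `x : (r × m) × Hom(K,ℂ) → ℂ`, where `U(x)` has columns
`A i *ᵥ (x ((e i).1, j), (e i).2))_j` (`A i` the matrix of `ω i`), takes the value `det 1 = 1` at
the assignment carrying `w`, so `P ≠ 0`; the density of the `K`-points gives `v` with
`B * U(v)` invertible, hence independent columns. -/
theorem exists_rat_linearIndependent (e : ι → r × (K →ₐ[ℚ] ℂ)) (he : Function.Injective e)
    (ω : ι → ((m → ℂ) →ₗ[ℂ] (p → ℂ))) (w : ι → m → ℂ)
    (hw : LinearIndependent ℂ fun i => ω i (w i)) :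
    ∃ v : r → m → K, LinearIndependent ℂ fun i => ω i (fun j => (e i).2 (v (e i).1 j)) := by
  classical
  set A : ι → Matrix p m ℂ := fun i => LinearMap.toMatrix' (ω i) with hA
  have hAω : ∀ i (x : m → ℂ), A i *ᵥ x = ω i x := fun i x => LinearMap.toMatrix'_mulVec (ω i) x
  obtain ⟨B, hB⟩ := exists_leftInverse_of_linearIndependent (fun i => ω i (w i)) hw
  -- the vector in `ℂ^m` that an assignment `x` of the variables produces for the index `i`
  set readVec : ((r × m) × (K →ₐ[ℚ] ℂ) → ℂ) → ι → m → ℂ :=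
    fun x i j => x (((e i).1, j), (e i).2) with hread
  -- the determinant polynomial `det (B * U(x))`
  set P : MvPolynomial ((r × m) × (K →ₐ[ℚ] ℂ)) ℂ :=
    Matrix.det (Matrix.of fun i i' =>
      ∑ r', C (B i r') * ∑ j, C (A i' r' j) * X (((e i').1, j), (e i').2)) with hP
  have hevalP : ∀ x : (r × m) × (K →ₐ[ℚ] ℂ) → ℂ,
      eval x P = (B * Matrix.of fun r' i => (A i *ᵥ readVec x i) r').det := by
    intro x
    rw [hP, RingHom.map_det]
    congr 1
    ext i i'
    simp only [RingHom.mapMatrix_apply, Matrix.map_apply, Matrix.of_apply, map_sum, map_mul,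
      eval_C, eval_X, Matrix.mul_apply, Matrix.mulVec, dotProduct, hread]
  -- the assignment carrying the complex witness `w`
  set x₀ : (r × m) × (K →ₐ[ℚ] ℂ) → ℂ :=
    fun q => ∑ i, if e i = (q.1.1, q.2) then w i q.1.2 else 0 with hx₀
  have hread₀ : ∀ i, readVec x₀ i = w i := by
    intro i
    funext j
    simp only [hread, hx₀]
    rw [Finset.sum_eq_single i]
    · exact if_pos rfl
    · intro b _ hb
      rw [if_neg]
      intro h
      exact hb (he (h.trans Prod.mk.eta))
    · intro h
      exact absurd (Finset.mem_univ i) h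
  have hPne : P ≠ 0 := by
    intro h0
    have h1 := hevalP x₀
    rw [h0, map_zero] at h1
    have h2 : (Matrix.of fun r' i => (A i *ᵥ readVec x₀ i) r') =
        Matrix.of fun r' i => ω i (w i) r' := by
      ext r' i
      rw [Matrix.of_apply, Matrix.of_apply, hread₀, hAω]
    rw [h2, hB, Matrix.det_one] at h1
    exact zero_ne_one h1
  obtain ⟨v, hv⟩ := exists_eval_embeddings_fintype_ne_zero K P hPne
  refine ⟨fun l j => v (l, j), ?_⟩
  rw [hevalP] at hv
  have hunit : IsUnit (B * Matrix.of fun r' i => (A i *ᵥ readVec (fun q => q.2 (v q.1)) i) r') :=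
    (Matrix.isUnit_iff_isUnit_det _).mpr (isUnit_iff_ne_zero.mpr hv)
  have hli := linearIndependent_of_isUnit_mul _ B hunit
  convert hli using 1
  funext i
  rw [← hAω]

/-- **R5 step (4), one copy.**  Distinct embeddings `σ i : K → ℂ` (the CM type); if some complex
`w` gives independent `ω i (w i)`, some rational `v : m → K` gives independent
`ω i ((σ i (v j))_j)`. -/
theorem exists_rat_linearIndependent_of_injective (σ : ι → (K →ₐ[ℚ] ℂ))
    (hσ : Function.Injective σ) (ω : ι → ((m → ℂ) →ₗ[ℂ] (p → ℂ))) (w : ι → m → ℂ)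
    (hw : LinearIndependent ℂ fun i => ω i (w i)) :
    ∃ v : m → K, LinearIndependent ℂ fun i => ω i (fun j => σ i (v j)) := by
  obtain ⟨v, hv⟩ := exists_rat_linearIndependent K (r := Unit) (fun i => ((), σ i))
    (fun a b h => hσ (congrArg Prod.snd h)) ω w hw
  exact ⟨v (), hv⟩

/-- **R5 steps (3)+(4).**  If every evaluation map `ω i : ℂ^m → ℂ^p` is surjective ("each
eigen-system spans `T_x^*`") and `g′ = |ι| ≤ p`, then some rational `v : m → K` makes the `g′`
evaluated eigenforms `ω i ((σ i (v j))_j)` linearly independent. -/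
theorem exists_rat_linearIndependent_of_surjective (σ : ι → (K →ₐ[ℚ] ℂ))
    (hσ : Function.Injective σ) (ω : ι → ((m → ℂ) →ₗ[ℂ] (p → ℂ)))
    (hω : ∀ i, Function.Surjective (ω i)) (hcard : Fintype.card ι ≤ Fintype.card p) :
    ∃ v : m → K, LinearIndependent ℂ fun i => ω i (fun j => σ i (v j)) := by
  obtain ⟨f⟩ := Function.Embedding.nonempty_of_card_le hcard
  choose w hw using fun i => hω i (Pi.single (f i) 1)
  have hli : LinearIndependent ℂ fun i => ω i (w i) := by
    simp only [hw]
    exact (Pi.linearIndependent_single_one p ℂ).comp f f.injective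
  exact exists_rat_linearIndependent_of_injective K σ hσ ω w hli

end main

section copies

variable {ι r m p : Type*} [Fintype r]
variable (K : Type*) [Field K] [NumberField K]

/-- **R5 step (5), the remark «this also shows `dim_T M ≥ r`».**  If the `r · |ι|` evaluated
eigenforms `Ω i ((σ i (v l j))_j)` — one for each copy `l` and each embedding `σ i` — are linearly
independent over `ℂ`, then the `r` rational vectors `v l ∈ K^m` are linearly independent over `K`
(`ι` non-empty). -/
theorem linearIndependent_of_linearIndependent_eval [Nonempty ι] (σ : ι → (K →ₐ[ℚ] ℂ))
    (Ω : ι → ((m → ℂ) →ₗ[ℂ] (p → ℂ))) (v : r → m → K)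
    (hli : LinearIndependent ℂ fun q : r × ι => Ω q.2 (fun j => σ q.2 (v q.1 j))) :
    LinearIndependent K v := by
  obtain ⟨i₀⟩ := ‹Nonempty ι›
  rw [Fintype.linearIndependent_iff]
  intro c hc l
  have hsub : LinearIndependent ℂ fun l : r => Ω i₀ (fun j => σ i₀ (v l j)) :=
    hli.comp (fun l : r => (l, i₀)) (fun a b h => (Prod.mk.inj h).1)
  rw [Fintype.linearIndependent_iff] at hsub
  have h1 : (fun j => σ i₀ (∑ l, c l * v l j)) = (0 : m → ℂ) := by
    funext j
    have hj := congrFun hc j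
    simp only [Finset.sum_apply, Pi.smul_apply, smul_eq_mul, Pi.zero_apply] at hj
    rw [hj, map_zero]
    rfl
  have hrel : ∑ l, σ i₀ (c l) • Ω i₀ (fun j => σ i₀ (v l j)) = 0 := by
    calc ∑ l, σ i₀ (c l) • Ω i₀ (fun j => σ i₀ (v l j))
        = Ω i₀ (∑ l, σ i₀ (c l) • fun j => σ i₀ (v l j)) := by
          rw [map_sum]
          simp only [map_smul]
      _ = Ω i₀ (fun j => σ i₀ (∑ l, c l * v l j)) := by
          congr 1
          funext j
          simp only [Finset.sum_apply, Pi.smul_apply, smul_eq_mul, map_sum, map_mul]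
      _ = 0 := by rw [h1, map_zero]
  exact (map_eq_zero (σ i₀)).mp (hsub (fun l => σ i₀ (c l)) hrel l)

end copies

end HodgeRepro.Zariski
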